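import Mathlib.Algebra.MvPolynomial.Variables
import Literature.Computability.AlgebraicComplexity.ArithCircuitProofs
import HarnessLib

/-!
# Variable counting for fan-in-two arithmetic circuits: `#vars(f) ≤ 2·L(f) + 1`

Topic `Literature/Computability/AlgebraicComplexity`.  Everything proved, no definitions, no
named facts: a fact-free API layer over the tree's `ArithCircuit` model (`ArithCircuit.lean`,
`ArithCircuitProofs.lean`).

A fan-in-two circuit with `s` gates mentions at most `2s` variables in its gates and one more in
its output operand, so a polynomial `f` over ANY commutative semiring computed by such a circuit
has `#vars(f) ≤ 2s + 1`; with the tree's `complexity` (minimal fan-in-two size),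
`#vars(f) ≤ 2·complexity f + 1` (`card_vars_le_complexity`).  The bookkeeping is gate by gate on
the fold semantics (`gateValues`, `Gate.eval`, `Operand.eval`), the sets of mentioned variables
being produced existentially so that no auxiliary definition is introduced
(`VarsCount.exists_vars_gateValues`).

Provenance: Literature copy (librarian sweep g22, promote event 3035193) of the generic `General`
section of
`Summits/ValiantsHypothesis/ValiantsHypothesis/Theorems/PerDivisionHard/Negative/VarsCounting.lean`
(refuter seat of stmt-ValiantsHypothesis-5065, 2026-08-16), which is imported cross-summit by
`Summits/MatrixMultiplication` Theorems (item stmt-MatrixMultiplication-7497) and quoted by route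
`DeterminantalIdealExponent`; proofs byte-identical, names kept (`VarsCount.*`,
`card_vars_le_of_computes`, `card_vars_le_complexity`) so that the Summits copies can later be
turned into aliases by a refactor item.  Deliberately NOT here: the permanent-specific floor
(`vars_perPoly_mul`, `sq_le_of_pair`, the `PerDivisionHard` rungs), which is problem-side.
-/

noncomputable section

namespace Literature.Computability.AlgebraicComplexity

open MvPolynomial

namespace VarsCount

open ArithCircuit

variable {k : Type} [CommSemiring k] {σ : Type} [DecidableEq σ]

/-! ### Semantics: a circuit computes a polynomial in few variables (no auxiliary definitions:
the set of "mentioned variables" is produced existentially, gate by gate) -/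

/-- The variables of a list sum. [folklore] -/
theorem vars_list_sum_subset (L : List (MvPolynomial σ k)) (W : Finset σ)
    (h : ∀ p ∈ L, p.vars ⊆ W) : L.sum.vars ⊆ W := by
  induction L with
  | nil => simp
  | cons p L ih =>
    rw [List.sum_cons]
    refine (vars_add_subset _ _).trans (Finset.union_subset (h p (by simp)) ?_)
    exact ih fun q hq => h q (by simp [hq])

/-- The variables of a list product. [folklore] -/
theorem vars_list_prod_subset (L : List (MvPolynomial σ k)) (W : Finset σ)
    (h : ∀ p ∈ L, p.vars ⊆ W) : L.prod.vars ⊆ W := by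
  induction L with
  | nil => rw [List.prod_nil, ← C_1, vars_C]; exact Finset.empty_subset _
  | cons p L ih =>
    rw [List.prod_cons]
    refine (vars_mul _ _).trans (Finset.union_subset (h p (by simp)) ?_)
    exact ih fun q hq => h q (by simp [hq])

/-- Scalar multiples do not add variables. [folklore] -/
theorem vars_smul_subset' (a : k) (p : MvPolynomial σ k) : (a • p).vars ⊆ p.vars := by
  rw [smul_eq_C_mul]
  refine (vars_mul _ _).trans ?_
  simp [vars_C]

/-- A variable is a polynomial in itself. [folklore] -/
theorem vars_X_subset_singleton (i : σ) : (X i : MvPolynomial σ k).vars ⊆ {i} := by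
  intro v hv
  rw [vars_def, Multiset.mem_toFinset] at hv
  simpa using Multiset.mem_of_le (degrees_X' i) hv

/-- An operand evaluates to a polynomial in at most ONE variable beyond those of the values it may
read. [folklore] -/
theorem exists_vars_operand_eval (vals : List (MvPolynomial σ k)) (W : Finset σ)
    (hvals : ∀ w ∈ vals, w.vars ⊆ W) (u : Operand k σ) :
    ∃ S : Finset σ, S.card ≤ 1 ∧ (u.eval vals).vars ⊆ S ∪ W := by
  cases u with
  | var i =>
    refine ⟨{i}, by simp, ?_⟩
    simp only [Operand.eval]
    exact (vars_X_subset_singleton i).trans Finset.subset_union_left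
  | const c => exact ⟨∅, by simp, by simp [Operand.eval, vars_C]⟩
  | gate j =>
    refine ⟨∅, by simp, ?_⟩
    simp only [Operand.eval, Finset.empty_union, List.getD_eq_getElem?_getD]
    cases hj : vals[j]? with
    | none => simp
    | some w =>
      simp only [Option.getD_some]
      exact hvals w (List.mem_of_getElem? hj)

/-- A list of operands evaluates within at most `length` variables beyond those of the values.
[folklore] -/
theorem exists_vars_operands_eval (vals : List (MvPolynomial σ k)) (W : Finset σ)
    (hvals : ∀ w ∈ vals, w.vars ⊆ W) (us : List (Operand k σ)) :
    ∃ S : Finset σ, S.card ≤ us.length ∧ ∀ u ∈ us, (u.eval vals).vars ⊆ S ∪ W := by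
  induction us with
  | nil => exact ⟨∅, by simp, by simp⟩
  | cons u us ih =>
    obtain ⟨S₁, hS₁, hu⟩ := exists_vars_operand_eval vals W hvals u
    obtain ⟨S₂, hS₂, hus⟩ := ih
    refine ⟨S₁ ∪ S₂, ?_, ?_⟩
    · calc (S₁ ∪ S₂).card ≤ S₁.card + S₂.card := Finset.card_union_le _ _
        _ ≤ (u :: us).length := by simp; omega
    · intro u' hu'
      rcases List.mem_cons.1 hu' with rfl | h'
      · exact hu.trans (Finset.union_subset_union Finset.subset_union_left le_rfl)
      · exact (hus u' h').trans (Finset.union_subset_union Finset.subset_union_right le_rfl)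

/-- A gate evaluates within at most `fanIn` variables beyond those of the earlier values.
[folklore] -/
theorem exists_vars_gate_eval (vals : List (MvPolynomial σ k)) (W : Finset σ)
    (hvals : ∀ w ∈ vals, w.vars ⊆ W) (g : Gate k σ) :
    ∃ S : Finset σ, S.card ≤ g.fanIn ∧ (g.eval vals).vars ⊆ S ∪ W := by
  obtain ⟨S, hS, hops⟩ := exists_vars_operands_eval vals W hvals g.args
  refine ⟨S, hS, ?_⟩
  cases g with
  | sum args =>
    simp only [Gate.eval]
    refine vars_list_sum_subset _ _ fun p hp => ?_
    obtain ⟨a, ha, rfl⟩ := List.mem_map.1 hp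
    refine (vars_smul_subset' _ _).trans (hops a.2 ?_)
    simp only [Gate.args]
    exact List.mem_map.2 ⟨a, ha, rfl⟩
  | prod args =>
    simp only [Gate.eval]
    refine vars_list_prod_subset _ _ fun p hp => ?_
    obtain ⟨u, hu, rfl⟩ := List.mem_map.1 hp
    exact hops u hu

/-- The values of a list of fan-in-two gates live in at most `2 · length` variables. [folklore] -/
theorem exists_vars_gateValues (gs : List (Gate k σ)) (h2 : ∀ g ∈ gs, g.fanIn ≤ 2) :
    ∃ W : Finset σ, W.card ≤ 2 * gs.length ∧ ∀ w ∈ gateValues gs, w.vars ⊆ W := by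
  induction gs using List.reverseRecOn with
  | nil => exact ⟨∅, by simp, by simp [gateValues]⟩
  | append_singleton gs g ih =>
    obtain ⟨W, hW, hvals⟩ := ih fun g' hg' => h2 g' (List.mem_append_left _ hg')
    obtain ⟨S, hS, hg⟩ := exists_vars_gate_eval (gateValues gs) W hvals g
    have hfan : g.fanIn ≤ 2 := h2 g (by simp)
    refine ⟨W ∪ S, ?_, ?_⟩
    · calc (W ∪ S).card ≤ W.card + S.card := Finset.card_union_le _ _
        _ ≤ 2 * (gs ++ [g]).length := by simp; omega
    · intro w hw
      rw [gateValues_append_singleton, List.mem_append, List.mem_singleton] at hw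
      rcases hw with hw | rfl
      · exact (hvals w hw).trans Finset.subset_union_left
      · rw [Finset.union_comm]; exact hg

end VarsCount

open VarsCount

section General

variable {k : Type} [CommSemiring k] {σ : Type} [DecidableEq σ]

/-- **Variable-counting floor.** A fan-in-two circuit of size `s` computing `f` forces
`#vars(f) ≤ 2s + 1`. [folklore] -/
theorem card_vars_le_of_computes {P : ArithCircuit k σ} {f : MvPolynomial σ k}
    (h2 : P.IsFanInTwo) (hf : P.Computes f) : f.vars.card ≤ 2 * P.size + 1 := by
  obtain ⟨W, hW, hvals⟩ := exists_vars_gateValues P.gates h2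
  obtain ⟨S, hS, hout⟩ :=
    exists_vars_operand_eval (ArithCircuit.gateValues P.gates) W hvals P.output
  have hsub : f.vars ⊆ S ∪ W := by
    rw [← show P.eval = f from hf]
    exact hout
  calc f.vars.card ≤ (S ∪ W).card := Finset.card_le_card hsub
    _ ≤ S.card + W.card := Finset.card_union_le _ _
    _ ≤ 2 * P.size + 1 := by unfold ArithCircuit.size; omega

/-- **`#vars(f) ≤ 2·L(f) + 1`** for the tree's fan-in-two `complexity`. [folklore] -/
theorem card_vars_le_complexity (f : MvPolynomial σ k) : f.vars.card ≤ 2 * complexity f + 1 := by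
  obtain ⟨P, h2, hf, hs⟩ := ArithCircuit.exists_computes_size_eq_complexity f
  rw [← hs]
  exact card_vars_le_of_computes h2 hf

end General

end Literature.Computability.AlgebraicComplexity

end
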